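import Mathlib
import Summits.NavierStokesRegularity.NavierStokesRegularity.Theorems.EulerZoomLiouvillePowerGaugeEulerLiouvilleFadingMildPast
import Summits.NavierStokesRegularity.NavierStokesRegularity.Theorems.EulerZoomLiouvillePowerGaugeEulerLiouvilleFadingPowerPast
import Literature.Analysis.FluidPDE.ClassicalSolutionRescale
import HarnessLib

/-!
# The Lagrangian «fading past» strata of the crux `EulerZoomLiouville.PowerGaugeEulerLiouville` (stmt-NavierStokesRegularity-19832)
# are CENTRE-FREE: exponentially / algebraically fading pasts tame about ANY point `x₀`, shifted mild breathers

Route `EulerZoomLiouville` (NavierStokesRegularity); extra-width seat ns-ezl-w7 g0 (line `logtime-breathers`, LEAD ns-typeII-p2 g11).  The Lagrangian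
strata of the line — the LEAD's exponentially fading tame past (`FadingPast.curl_eq_zero`, T2b in physical form), ns-ezl-w4's mild widening
(`FadingPast.curl_eq_zero_rpow`), this seat's algebraically fading past (`FadingPowerPast.curl_eq_zero`) — ask the velocity GRADIENT to decay in the
breathing variable ABOUT THE ORIGIN, `‖∇u(t, y)‖ ≤ C(1 + e^{−ct}‖y‖)^{−q}` (resp. off balls `‖y‖ ≥ δ`), because the trapped set of the argument is
written about `0`.  But that argument uses NO gauge: it only produces `curl u ≡ 0` on the past sub-slab, and the class enters afterwards through
`PastIrrotational.ae_eq_zero_of_gauge_of_pastIrrotational` (harmonic slices killed by the origin-centred `A`-gauge).  Since the Euler system is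
translation covariant (`IsClassicalNSSolutionOn.spaceTranslate`) and `curl` commutes with translations, the decay may be centred at ANY `x₀ ∈ ℝ³`:
translate, kill the vorticity, translate back.  So every Lagrangian stratum is centre-free although the class is not translation invariant.

* `isClassicalEulerSolutionOn_translate`, `curl_eq_zero_of_translate` — bookkeeping;
* `FadingPast.curl_eq_zero_rpow_shifted`, `FadingPast.ae_eq_zero_of_gauge_of_fadingMildPast_shifted` — `‖u‖ ≤ Me^{ct}`,
  `‖∇u(t,y)‖ ≤ C(1 + e^{−ct}‖y − x₀‖)^{−q}` (`c, q > 0`) on `(−∞, T₁)` ⇒ trivial;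
* `FadingPowerPast.curl_eq_zero_shifted`, `FadingPowerPast.ae_eq_zero_of_gauge_of_fadingPowerPast_shifted` — `‖u‖ ≤ M(T₀−t)^{−m}` (`m > 1`),
  `‖∇u‖ ≤ K`, and `‖∇u(t,y)‖ ≤ D(T₀−t)^{−k}` (`k > 1`) off the balls `‖y − x₀‖ ≥ δ` ⇒ trivial;
* `LogtimeBreather.ae_eq_zero_of_gauge_of_mildBreather_shifted` — SHIFTED MILD BREATHERS on a past sub-slab: `u(τ, y) = e^{cτ} V(e^{−cτ}(y − x₀))`
  for `τ < T₁` (`T₁ ≤ 0`, `c > 0`), `‖V‖ ≤ B`, `‖∇V(z)‖ ≤ C(1+‖z‖)^{−q}` (`q > 0`) ⇒ trivial (ns-ezl-w4's `…mildBreather` is `x₀ = 0`, `T₁ = 0`;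
  ns-ezl-w4's breather RIGIDITY `…classicalBreather` — no tameness — is centred at the origin and reads the gauges in profile variables, so it does
  not transfer by translation; the Lagrangian stratum does).

WHAT THIS IS NOT: not NS, not E — classical strata of the crux CLASS 19832 on the MODEL lattice, `--supports` stmt-19832. [folklore;
MajdaBertozziCUP2002 §1.6 Prop 1.8, §2.5 (2.115)–(2.117); line card `Cruxes/PowerGaugeEulerLiouville/Lines/logtime-breathers.md` T2b/T3]
-/

noncomputable section

-- flat `Theorems/<Route><Decl>…` files of one crux share the namespace of the crux (tree convention: `Summit.<S>.<S>.…`)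
set_option linter.dupNamespace false

open MeasureTheory Set Filter Topology Metric Function
open scoped ENNReal NNReal

namespace Summit.NavierStokesRegularity.NavierStokesRegularity.Theorems.PowerGaugeEulerLiouville

open Literature.Analysis Literature.Analysis.FunctionSpaces Literature.Analysis.FluidPDE

/-! ### Translation bookkeeping -/

section Translate

variable {u : ℝ → EuclideanSpace ℝ (Fin 3) → EuclideanSpace ℝ (Fin 3)} {p : ℝ → EuclideanSpace ℝ (Fin 3) → ℝ} {S : Set ℝ}

/-- The space translate `(u(t, x₀ + ·), p(t, x₀ + ·))` of a classical Euler solution is a classical Euler solution. [folklore] -/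
theorem isClassicalEulerSolutionOn_translate (hcl : IsClassicalEulerSolutionOn S 0 u p) (x₀ : EuclideanSpace ℝ (Fin 3)) :
    IsClassicalEulerSolutionOn S 0 (fun t x => u t (x₀ + x)) (fun t x => p t (x₀ + x)) := by
  have h := hcl.spaceTranslate x₀
  exact h

/-- Vorticity-freeness transfers back from the translate (`curl` commutes with translations — the tree's `curl_translate` of the
`PoloidalExtremal` file, inlined here as `simp only [curl, fderiv_comp_add_left]` to keep the import cone inside this crux). [folklore] -/
theorem curl_eq_zero_of_translate {v : EuclideanSpace ℝ (Fin 3) → EuclideanSpace ℝ (Fin 3)} {x₀ : EuclideanSpace ℝ (Fin 3)}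
    (h : ∀ y, curl (fun x => v (x₀ + x)) y = 0) (x : EuclideanSpace ℝ (Fin 3)) : curl v x = 0 := by
  have h1 := h (x - x₀)
  simp only [curl, fderiv_comp_add_left, add_sub_cancel] at h1
  simpa only [curl] using h1

end Translate

/-! ### Exponentially fading mild past about any centre -/

namespace FadingPast

variable {u : ℝ → EuclideanSpace ℝ (Fin 3) → EuclideanSpace ℝ (Fin 3)} {p : ℝ → EuclideanSpace ℝ (Fin 3) → ℝ}
  {T₁ c M C q : ℝ} {x₀ : EuclideanSpace ℝ (Fin 3)}

/-- **A classical Euler flow with an exponentially fading past, mildly tame ABOUT A CENTRE `x₀`, is irrotational**: `‖u(t,y)‖ ≤ M e^{ct}`,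
`‖∇u(t,y)‖ ≤ C(1 + e^{−ct}‖y − x₀‖)^{−q}` on `(−∞, T₁)` (`c, q > 0`) ⇒ `curl u(τ) ≡ 0` for `τ < T₁` (translate by `x₀`, apply ns-ezl-w4's
`curl_eq_zero_rpow`, translate back). [folklore] -/
theorem curl_eq_zero_rpow_shifted (hcl : IsClassicalEulerSolutionOn (Iio T₁) 0 u p) (hc : 0 < c) (hq : 0 < q)
    (hvel : ∀ s : ℝ, s < T₁ → ∀ y, ‖u s y‖ ≤ M * Real.exp (c * s))
    (hgrad : ∀ s : ℝ, s < T₁ → ∀ y, ‖fderiv ℝ (u s) y‖ ≤ C * (1 + Real.exp (-(c * s)) * ‖y - x₀‖) ^ (-q))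
    {τ : ℝ} (hτ : τ < T₁) (x : EuclideanSpace ℝ (Fin 3)) : curl (u τ) x = 0 := by
  have hcl' := isClassicalEulerSolutionOn_translate hcl x₀
  have hvel' : ∀ s : ℝ, s < T₁ → ∀ y, ‖(fun t x => u t (x₀ + x)) s y‖ ≤ M * Real.exp (c * s) :=
    fun s hs y => hvel s hs _
  have hgrad' : ∀ s : ℝ, s < T₁ → ∀ y, ‖fderiv ℝ ((fun t x => u t (x₀ + x)) s) y‖ ≤
      C * (1 + Real.exp (-(c * s)) * ‖y‖) ^ (-q) := by
    intro s hs y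
    have h := hgrad s hs (x₀ + y)
    rw [add_sub_cancel_left] at h
    simpa only [fderiv_comp_add_left] using h
  exact curl_eq_zero_of_translate (fun y => curl_eq_zero_rpow hcl' hc hq hvel' hgrad' hτ y) x

/-- **MEMBERS WITH AN EXPONENTIALLY FADING PAST, MILDLY TAME ABOUT ANY CENTRE, ARE TRIVIAL**: crux hypotheses verbatim (`0 < ρ ≤ ½`) + classical on
`(−∞, T₁)`, `T₁ ≤ 0`, `‖u(t,y)‖ ≤ M e^{ct}`, `‖∇u(t,y)‖ ≤ C(1 + e^{−ct}‖y − x₀‖)^{−q}` (`c, q > 0`, any `x₀ ∈ ℝ³`) ⇒ `u = 0` a.e. on `(−∞,0) × ℝ³`.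
(`x₀ = 0`: ns-ezl-w4's `ae_eq_zero_of_gauge_of_fadingMildPast` ⊇ the LEAD's `…fadingTamePast`.) [folklore] -/
theorem ae_eq_zero_of_gauge_of_fadingMildPast_shifted {ρ : ℝ} (hρ : 0 < ρ) (hρh : ρ ≤ 1 / 2)
    {H : ℝ → EuclideanSpace ℝ (Fin 3) → EuclideanSpace ℝ (Fin 3) →L[ℝ] EuclideanSpace ℝ (Fin 3)} {c₀ : ℝ≥0}
    (hsw : IsSuitableWeakSolutionOn (slab (EuclideanSpace ℝ (Fin 3)) (Iio 0) isOpen_Iio) 0 0 u p)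
    (hH : HasWeakSpatialGradientOn (slab (EuclideanSpace ℝ (Fin 3)) (Iio 0) isOpen_Iio) u H)
    (hgauge : ∀ a : ℝ, 0 < a →
      ENNReal.ofReal (a ^ (2 * ρ)) * cknA a (0 : ℝ × EuclideanSpace ℝ (Fin 3)) u +
          ENNReal.ofReal (a ^ ρ) * cknE a (0 : ℝ × EuclideanSpace ℝ (Fin 3)) H +
        ENNReal.ofReal (a ^ (2 * ρ)) * cknD a (0 : ℝ × EuclideanSpace ℝ (Fin 3)) p ≤ (c₀ : ℝ≥0∞))
    (hT₁ : T₁ ≤ 0) (hcl : IsClassicalEulerSolutionOn (Iio T₁) 0 u p) (hc : 0 < c) (hq : 0 < q) (x₀ : EuclideanSpace ℝ (Fin 3))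
    (hvel : ∀ s : ℝ, s < T₁ → ∀ y, ‖u s y‖ ≤ M * Real.exp (c * s))
    (hgrad : ∀ s : ℝ, s < T₁ → ∀ y, ‖fderiv ℝ (u s) y‖ ≤ C * (1 + Real.exp (-(c * s)) * ‖y - x₀‖) ^ (-q)) :
    uncurry u =ᵐ[volume.restrict (Iio (0 : ℝ) ×ˢ (univ : Set (EuclideanSpace ℝ (Fin 3))))] 0 :=
  PastIrrotational.ae_eq_zero_of_gauge_of_pastIrrotational hρ hρh hsw hH hgauge hT₁
    (fun τ hτ => (hcl.contDiff_velocity hτ).of_le (by norm_cast))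
    (fun τ hτ => hcl.divFree τ hτ) (fun τ hτ x => curl_eq_zero_rpow_shifted hcl hc hq hvel hgrad hτ x)

end FadingPast

/-! ### Algebraically fading tame past about any centre -/

namespace FadingPowerPast

variable {u : ℝ → EuclideanSpace ℝ (Fin 3) → EuclideanSpace ℝ (Fin 3)} {p : ℝ → EuclideanSpace ℝ (Fin 3) → ℝ}
  {T₁ T₀ M m K : ℝ} {x₀ : EuclideanSpace ℝ (Fin 3)}

/-- **A classical Euler flow with an algebraically fading past, tame ABOUT A CENTRE `x₀`, is irrotational**: on `(−∞, T₁)`, `T₁ ≤ T₀`: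
`‖u(t,y)‖ ≤ M(T₀−t)^{−m}` (`m > 1`), `‖∇u‖ ≤ K`, and for every `δ > 0` some `D`, `k > 1` with `‖∇u(t,y)‖ ≤ D(T₀−t)^{−k}` whenever `‖y − x₀‖ ≥ δ`
⇒ `curl u(τ) ≡ 0` for `τ < T₁` (translate by `x₀`, apply `FadingPowerPast.curl_eq_zero`, translate back). [folklore] -/
theorem curl_eq_zero_shifted (hcl : IsClassicalEulerSolutionOn (Iio T₁) 0 u p) (hT : T₁ ≤ T₀) (hm : 1 < m)
    (hvel : ∀ s : ℝ, s < T₁ → ∀ y, ‖u s y‖ ≤ M * (T₀ - s) ^ (-m))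
    (hK : ∀ s : ℝ, s < T₁ → ∀ y, ‖fderiv ℝ (u s) y‖ ≤ K)
    (hgrad : ∀ δ : ℝ, 0 < δ → ∃ D k : ℝ, 1 < k ∧
      ∀ s : ℝ, s < T₁ → ∀ y : EuclideanSpace ℝ (Fin 3), δ ≤ ‖y - x₀‖ → ‖fderiv ℝ (u s) y‖ ≤ D * (T₀ - s) ^ (-k))
    {τ : ℝ} (hτ : τ < T₁) (x : EuclideanSpace ℝ (Fin 3)) : curl (u τ) x = 0 := by
  have hcl' := isClassicalEulerSolutionOn_translate hcl x₀
  obtain ⟨s₀, hs₀⟩ := exists_lt T₁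
  have hK0 : 0 ≤ K := (norm_nonneg _).trans (hK s₀ hs₀ 0)
  have hvel' : ∀ s : ℝ, s < T₁ → ∀ y, ‖(fun t x => u t (x₀ + x)) s y‖ ≤ M * (T₀ - s) ^ (-m) :=
    fun s hs y => hvel s hs _
  have hLip : ∀ s : ℝ, s < T₁ → LipschitzWith ⟨K, hK0⟩ ((fun t x => u t (x₀ + x)) s) := by
    intro s hs
    refine lipschitzWith_of_nnnorm_fderiv_le ((hcl'.contDiff_velocity hs).differentiable (by simp)) fun y => ?_
    have h : (‖fderiv ℝ ((fun t x => u t (x₀ + x)) s) y‖₊ : ℝ) ≤ K := by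
      rw [coe_nnnorm]
      simpa only [fderiv_comp_add_left] using hK s hs (x₀ + y)
    exact_mod_cast h
  have hgrad' : ∀ δ : ℝ, 0 < δ → ∃ D k : ℝ, 1 < k ∧
      ∀ s : ℝ, s < T₁ → ∀ y : EuclideanSpace ℝ (Fin 3), δ ≤ ‖y‖ →
        ‖fderiv ℝ ((fun t x => u t (x₀ + x)) s) y‖ ≤ D * (T₀ - s) ^ (-k) := by
    intro δ hδ
    obtain ⟨D, k, hk, hD⟩ := hgrad δ hδ
    refine ⟨D, k, hk, fun s hs y hy => ?_⟩
    have h := hD s hs (x₀ + y) (by rwa [add_sub_cancel_left])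
    simpa only [fderiv_comp_add_left] using h
  exact curl_eq_zero_of_translate (fun y => curl_eq_zero hcl' hT hm hvel' hLip hgrad' hτ y) x

/-- **MEMBERS WITH AN ALGEBRAICALLY FADING PAST, TAME ABOUT ANY CENTRE, ARE TRIVIAL** (real-constant form): crux hypotheses verbatim
(`0 < ρ ≤ ½`) + classical on `(−∞, T₁)`, `T₁ ≤ 0`, `T₁ ≤ T₀`, `‖u(t,y)‖ ≤ M(T₀−t)^{−m}` (`m > 1`), `‖∇u‖ ≤ K`, and for every `δ > 0` some `D`, `k > 1`
with `‖∇u(t,y)‖ ≤ D(T₀−t)^{−k}` whenever `‖y − x₀‖ ≥ δ` ⇒ `u = 0` a.e.  (`x₀ = 0`: `ae_eq_zero_of_gauge_of_fadingPowerPast_of_norm_fderiv_le`.) [folklore] -/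
theorem ae_eq_zero_of_gauge_of_fadingPowerPast_shifted {ρ : ℝ} (hρ : 0 < ρ) (hρh : ρ ≤ 1 / 2)
    {H : ℝ → EuclideanSpace ℝ (Fin 3) → EuclideanSpace ℝ (Fin 3) →L[ℝ] EuclideanSpace ℝ (Fin 3)} {c₀ : ℝ≥0}
    (hsw : IsSuitableWeakSolutionOn (slab (EuclideanSpace ℝ (Fin 3)) (Iio 0) isOpen_Iio) 0 0 u p)
    (hH : HasWeakSpatialGradientOn (slab (EuclideanSpace ℝ (Fin 3)) (Iio 0) isOpen_Iio) u H)
    (hgauge : ∀ a : ℝ, 0 < a →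
      ENNReal.ofReal (a ^ (2 * ρ)) * cknA a (0 : ℝ × EuclideanSpace ℝ (Fin 3)) u +
          ENNReal.ofReal (a ^ ρ) * cknE a (0 : ℝ × EuclideanSpace ℝ (Fin 3)) H +
        ENNReal.ofReal (a ^ (2 * ρ)) * cknD a (0 : ℝ × EuclideanSpace ℝ (Fin 3)) p ≤ (c₀ : ℝ≥0∞))
    (hT₁ : T₁ ≤ 0) (hT : T₁ ≤ T₀) (hcl : IsClassicalEulerSolutionOn (Iio T₁) 0 u p) (hm : 1 < m) (x₀ : EuclideanSpace ℝ (Fin 3))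
    (hvel : ∀ s : ℝ, s < T₁ → ∀ y, ‖u s y‖ ≤ M * (T₀ - s) ^ (-m))
    (hK : ∀ s : ℝ, s < T₁ → ∀ y, ‖fderiv ℝ (u s) y‖ ≤ K)
    (hgrad : ∀ δ : ℝ, 0 < δ → ∃ D k : ℝ, 1 < k ∧
      ∀ s : ℝ, s < T₁ → ∀ y : EuclideanSpace ℝ (Fin 3), δ ≤ ‖y - x₀‖ → ‖fderiv ℝ (u s) y‖ ≤ D * (T₀ - s) ^ (-k)) :
    uncurry u =ᵐ[volume.restrict (Iio (0 : ℝ) ×ˢ (univ : Set (EuclideanSpace ℝ (Fin 3))))] 0 :=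
  PastIrrotational.ae_eq_zero_of_gauge_of_pastIrrotational hρ hρh hsw hH hgauge hT₁
    (fun τ hτ => (hcl.contDiff_velocity hτ).of_le (by norm_cast))
    (fun τ hτ => hcl.divFree τ hτ) (fun τ hτ x => curl_eq_zero_shifted hcl hT hm hvel hK hgrad hτ x)

end FadingPowerPast

/-! ### Shifted mild breathers on a past sub-slab -/

namespace LogtimeBreather

variable {u : ℝ → EuclideanSpace ℝ (Fin 3) → EuclideanSpace ℝ (Fin 3)} {p : ℝ → EuclideanSpace ℝ (Fin 3) → ℝ}

/-- **SHIFTED MILD LOG-TIME BREATHERS ON A PAST SUB-SLAB ARE TRIVIAL.**  Crux hypotheses verbatim (`0 < ρ ≤ ½`) + `(u, p)` classical on `(−∞, T₁)`,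
`T₁ ≤ 0` + `u(τ, y) = e^{cτ} V(e^{−cτ}(y − x₀))` for `τ < T₁` with `c > 0`, ANY centre `x₀` + `‖V(z)‖ ≤ B` + `‖∇V(z)‖ ≤ C(1 + ‖z‖)^{−q}` (`q > 0`)
⇒ `u = 0` a.e. on `(−∞,0) × ℝ³`: `‖u(τ,y)‖ ≤ B e^{cτ}`, `∇u(τ, y) = ∇V(e^{−cτ}(y − x₀))`, so the past fades exponentially and is mildly tame about `x₀`
(`FadingPast.ae_eq_zero_of_gauge_of_fadingMildPast_shifted`).  ns-ezl-w4's `ae_eq_zero_of_gauge_of_mildBreather` is `x₀ = 0`, `T₁ = 0`. [folklore] -/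
theorem ae_eq_zero_of_gauge_of_mildBreather_shifted {ρ : ℝ} (hρ : 0 < ρ) (hρh : ρ ≤ 1 / 2)
    {H : ℝ → EuclideanSpace ℝ (Fin 3) → EuclideanSpace ℝ (Fin 3) →L[ℝ] EuclideanSpace ℝ (Fin 3)} {c₀ : ℝ≥0}
    (hsw : IsSuitableWeakSolutionOn (slab (EuclideanSpace ℝ (Fin 3)) (Iio 0) isOpen_Iio) 0 0 u p)
    (hH : HasWeakSpatialGradientOn (slab (EuclideanSpace ℝ (Fin 3)) (Iio 0) isOpen_Iio) u H)
    (hgauge : ∀ a : ℝ, 0 < a →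
      ENNReal.ofReal (a ^ (2 * ρ)) * cknA a (0 : ℝ × EuclideanSpace ℝ (Fin 3)) u +
          ENNReal.ofReal (a ^ ρ) * cknE a (0 : ℝ × EuclideanSpace ℝ (Fin 3)) H +
        ENNReal.ofReal (a ^ (2 * ρ)) * cknD a (0 : ℝ × EuclideanSpace ℝ (Fin 3)) p ≤ (c₀ : ℝ≥0∞))
    {T₁ : ℝ} (hT₁ : T₁ ≤ 0) (hcl : IsClassicalEulerSolutionOn (Iio T₁) 0 u p) {c : ℝ}
    {V : EuclideanSpace ℝ (Fin 3) → EuclideanSpace ℝ (Fin 3)} (x₀ : EuclideanSpace ℝ (Fin 3))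
    (hc : 0 < c) (hbr : ∀ τ : ℝ, τ < T₁ → ∀ y, u τ y = Real.exp (c * τ) • V (Real.exp (-(c * τ)) • (y - x₀)))
    {B C q : ℝ} (hVb : ∀ z, ‖V z‖ ≤ B) (hq : 0 < q) (hVgrad : ∀ z, ‖fderiv ℝ V z‖ ≤ C * (1 + ‖z‖) ^ (-q)) :
    uncurry u =ᵐ[volume.restrict (Iio (0 : ℝ) ×ˢ (univ : Set (EuclideanSpace ℝ (Fin 3))))] 0 := by
  -- adapted from …FadingMildPast (`LogtimeBreather.ae_eq_zero_of_gauge_of_mildBreather`, ns-ezl-w4): slice `T₁ − 1`, centre `x₀`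
  set τ₀ : ℝ := T₁ - 1 with hτ₀
  have hτ₀T : τ₀ < T₁ := by rw [hτ₀]; linarith
  -- the profile in terms of the slice `τ₀`: `V z = e^{−cτ₀} u(τ₀, x₀ + e^{cτ₀} z)`
  have hVrep : V = fun z => Real.exp (-(c * τ₀)) • u τ₀ (x₀ + Real.exp (c * τ₀) • z) := by
    funext z
    have h := hbr τ₀ hτ₀T (x₀ + Real.exp (c * τ₀) • z)
    rw [add_sub_cancel_left, smul_smul, ← Real.exp_add, neg_add_cancel, Real.exp_zero, one_smul] at h
    rw [h, smul_smul, ← Real.exp_add, neg_add_cancel, Real.exp_zero, one_smul]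
  have hV : ContDiff ℝ 1 V := by
    rw [hVrep]
    have h1 : ContDiff ℝ 1 (u τ₀) := (hcl.contDiff_velocity hτ₀T).of_le (by exact_mod_cast le_top)
    have hmap : ContDiff ℝ 1 (fun z : EuclideanSpace ℝ (Fin 3) => x₀ + Real.exp (c * τ₀) • z) :=
      contDiff_const.add (contDiff_id.const_smul _)
    exact (h1.comp hmap).const_smul _
  have hVd : Differentiable ℝ V := hV.differentiable one_ne_zero
  -- (H1) exponentially fading velocity
  have hvel : ∀ s : ℝ, s < T₁ → ∀ y, ‖u s y‖ ≤ B * Real.exp (c * s) := by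
    intro s hs y
    rw [hbr s hs y, norm_smul, Real.norm_eq_abs, abs_of_pos (Real.exp_pos _), mul_comm]
    exact mul_le_mul_of_nonneg_right (hVb _) (Real.exp_pos _).le
  -- the gradient in the breathing variable about `x₀`: `∇u(s, y) = ∇V(e^{−cs}(y − x₀))`
  have hder : ∀ s : ℝ, s < T₁ → ∀ y, fderiv ℝ (u s) y = fderiv ℝ V (Real.exp (-(c * s)) • (y - x₀)) := by
    intro s hs y
    have hus : u s = fun y => Real.exp (c * s) • V (Real.exp (-(c * s)) • (y - x₀)) := funext (hbr s hs)
    have h : HasFDerivAt (u s) (fderiv ℝ V (Real.exp (-(c * s)) • (y - x₀))) y := by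
      rw [hus]
      have h0 : HasFDerivAt (fun y : EuclideanSpace ℝ (Fin 3) => y - x₀) (ContinuousLinearMap.id ℝ (EuclideanSpace ℝ (Fin 3))) y :=
        (hasFDerivAt_id y).sub_const x₀
      have h1 : HasFDerivAt (fun y : EuclideanSpace ℝ (Fin 3) => Real.exp (-(c * s)) • (y - x₀))
          (Real.exp (-(c * s)) • ContinuousLinearMap.id ℝ (EuclideanSpace ℝ (Fin 3))) y := by
        have h1' := h0.const_smul (Real.exp (-(c * s)))
        simpa only [Pi.smul_def] using h1'
      have h2 := ((hVd (Real.exp (-(c * s)) • (y - x₀))).hasFDerivAt.comp y h1).const_smul (Real.exp (c * s))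
      refine h2.congr_fderiv (ContinuousLinearMap.ext fun v => ?_)
      simp only [FunLike.coe_smul, Pi.smul_apply, ContinuousLinearMap.comp_apply, ContinuousLinearMap.id_apply,
        map_smul, smul_smul, ← Real.exp_add, add_neg_cancel, Real.exp_zero, one_smul]
    exact h.fderiv
  -- (H2) the mild gradient about `x₀`
  have hgrad : ∀ s : ℝ, s < T₁ → ∀ y, ‖fderiv ℝ (u s) y‖ ≤ C * (1 + Real.exp (-(c * s)) * ‖y - x₀‖) ^ (-q) := by
    intro s hs y
    rw [hder s hs y]
    have h := hVgrad (Real.exp (-(c * s)) • (y - x₀))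
    rwa [norm_smul, Real.norm_eq_abs, abs_of_pos (Real.exp_pos _)] at h
  exact FadingPast.ae_eq_zero_of_gauge_of_fadingMildPast_shifted hρ hρh hsw hH hgauge hT₁ hcl hc hq x₀ hvel hgrad

end LogtimeBreather

end Summit.NavierStokesRegularity.NavierStokesRegularity.Theorems.PowerGaugeEulerLiouville

end
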